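import Mathlib
import Literature.RepresentationTheory.AlgebraicGroups.SpecialLinearCoordinateRingDomain
import Literature.RepresentationTheory.AlgebraicGroups.HilbertMumfordTensorValuation
import Literature.Computability.AlgebraicComplexity.QuantumFunctionalsFree
import HarnessLib

/-!
# Hilbert–Mumford for `SL_m(ℂ)³` on `3`-tensors, III: identities on the orbit and the torus curve

Third file of the proof of `Kempf1978_thm14_tensor` (valuative method); theorems only.

* `eval₂_orbit_eq_zero_of_vanish` — **extension of identities**: a polynomial `f ∈ ℂ[y_c]`
  vanishing on the orbit `SL_ι(ℂ)³·w` vanishes on `g·w` for every `g ∈ SL_ι(A)³` over ANY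
  commutative `ℂ`-algebra `ρ : ℂ → A` (coefficients pushed along `ρ`). Proof: `f(X·w) ∈ ℂ[x]`
  vanishes on `SL³(ℂ) = V(J)`, so lies in `√J = J` (Nullstellensatz; `J` is prime,
  `isPrime_span_det_sub_one`), and `J` dies under `x ↦ g`.
* `eval₂_trunc_eq_zero_of_vanish` — **the torus curve**: with integer weights `α, β, γ` of
  total sums `0`, a tensor `z'` in the `SL_ι(κ)³`-orbit of `w` (over a field `κ ⊇ ρ(ℂ)`,
  infinite) vanishing on the cells of positive weight, and `z` its truncation to weight `0`, every
  `f` vanishing on `SL³(ℂ)·w` vanishes at `z`: `s ↦ f(λ(s)·z')`, `λ(s) = diag(s^{-α}, s^{-β}, s^{-γ})`,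
  is a polynomial in `s` vanishing for `s ≠ 0`, hence at `s = 0`, where its value is `f(z)`.
-/

noncomputable section

open MvPolynomial Matrix
open scoped BigOperators

namespace Literature.RepresentationTheory.AlgebraicGroups

open Literature.Computability.AlgebraicComplexity

variable {ι : Type} [Fintype ι] [DecidableEq ι]

/-! ### Compositions of evaluations -/

/-- `eval₂Hom ψ x ∘ aeval h = eval₂Hom (ψ') (eval₂Hom ψ x ∘ h)` for `ℂ`-polynomial substitutions:
evaluating a substituted polynomial is evaluating at the evaluated substitution. [folklore] -/
theorem eval₂Hom_comp_aeval {σ τ A : Type*} [CommRing A] (ψ : ℂ →+* A) (x : σ → A)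
    (h : τ → MvPolynomial σ ℂ) (f : MvPolynomial τ ℂ) :
    eval₂Hom ψ x (aeval h f) = eval₂ ψ (fun t => eval₂Hom ψ x (h t)) f := by
  rw [← coe_eval₂Hom]
  change ((eval₂Hom ψ x).comp (aeval h).toRingHom) f = (eval₂Hom ψ fun t => eval₂Hom ψ x (h t)) f
  congr 1
  refine MvPolynomial.ringHom_ext (fun z => ?_) (fun t => ?_)
  · simp
  · simp

/-- `aeval x ∘ aeval h = aeval (aeval x ∘ h)`. [folklore] -/
theorem aeval_aeval_eq {σ τ A : Type*} [CommRing A] [Algebra ℂ A] (x : σ → A)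
    (h : τ → MvPolynomial σ ℂ) (f : MvPolynomial τ ℂ) :
    aeval x (aeval h f) = aeval (fun t => aeval x (h t)) f := by
  rw [← AlgHom.comp_apply]
  congr 1
  exact MvPolynomial.algHom_ext fun t => by simp

/-! ### Identities extend from `SL³(ℂ)` to `SL³(A)` -/

/-- **Identities on the orbit extend to all base rings.** If `f ∈ ℂ[y_c]` vanishes at `g·w` for
every `g ∈ SL_ι(ℂ)³`, then for every commutative ring `A`, ring map `ρ : ℂ → A` and
`g ∈ SL_ι(A)³`: `f^ρ(g·w^ρ) = 0`. [folklore] -/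
theorem eval₂_orbit_eq_zero_of_vanish (w : ι → ι → ι → ℂ) (f : MvPolynomial (ι × ι × ι) ℂ)
    (hf : ∀ g : Matrix.SpecialLinearGroup ι ℂ × Matrix.SpecialLinearGroup ι ℂ ×
        Matrix.SpecialLinearGroup ι ℂ,
      aeval (fun c : ι × ι × ι => actTensor (g.1 : Matrix ι ι ℂ) (g.2.1 : Matrix ι ι ℂ)
        (g.2.2 : Matrix ι ι ℂ) w c.1 c.2.1 c.2.2) f = 0)
    {A : Type*} [CommRing A] (ρ : ℂ →+* A) (g : Fin 3 → Matrix ι ι A) (hg : ∀ p, (g p).det = 1) :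
    eval₂ ρ (fun c : ι × ι × ι => actTensor (g 0) (g 1) (g 2)
      (fun a b c => ρ (w a b c)) c.1 c.2.1 c.2.2) f = 0 := by
  classical
  set Xm : Fin 3 → Matrix ι ι (MvPolynomial (Fin 3 × ι × ι) ℂ) := fun p =>
    Matrix.of fun i j => X (p, i, j) with hXm
  set J : Ideal (MvPolynomial (Fin 3 × ι × ι) ℂ) := Ideal.span (Set.range fun p : Fin 3 =>
    (Matrix.of fun i j => (X (p, i, j) : MvPolynomial (Fin 3 × ι × ι) ℂ)).det - 1) with hJ
  -- `F = f(X·w)`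
  set sub : ι × ι × ι → MvPolynomial (Fin 3 × ι × ι) ℂ := fun c =>
    actTensor (Xm 0) (Xm 1) (Xm 2) (fun a b c => C (w a b c)) c.1 c.2.1 c.2.2 with hsub
  set F : MvPolynomial (Fin 3 × ι × ι) ℂ := aeval sub f with hF
  -- `F` vanishes on `V(J)(ℂ) = SL³(ℂ)`
  have hFvan : F ∈ vanishingIdeal ℂ (zeroLocus ℂ J) := by
    rw [mem_vanishingIdeal_iff]
    intro x hx
    rw [mem_zeroLocus_iff] at hx
    set gx : Fin 3 → Matrix ι ι ℂ := fun p => Matrix.of fun i j => x (p, i, j) with hgx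
    have hdet : ∀ p, (gx p).det = 1 := by
      intro p
      have h := hx _ (Ideal.subset_span ⟨p, rfl⟩)
      rw [map_sub, map_one, AlgHom.map_det, sub_eq_zero] at h
      convert h using 2
      ext i j
      simp [hgx]
    have h1 : aeval x F = aeval (fun c : ι × ι × ι => actTensor (gx 0) (gx 1) (gx 2) w
        c.1 c.2.1 c.2.2) f := by
      rw [hF, aeval_aeval_eq]
      have e1 : ∀ p, (Xm p).map (aeval x) = gx p := fun p => by
        ext i j; simp [hXm, hgx]
      have e2 : (fun a b c' => aeval x (C (w a b c') : MvPolynomial (Fin 3 × ι × ι) ℂ)) = w := by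
        funext a b c'; simp
      congr 2
      funext c
      rw [hsub, map_actTensor, e1, e1, e1, e2]
    rw [h1]
    exact hf (⟨gx 0, hdet 0⟩, ⟨gx 1, hdet 1⟩, ⟨gx 2, hdet 2⟩)
  -- hence `F ∈ J` (Nullstellensatz, `J` prime)
  haveI : J.IsPrime := hJ ▸ isPrime_span_det_sub_one ℂ (Fin 3) ι
  have hFJ : F ∈ J := by
    rw [vanishingIdeal_zeroLocus_eq_radical, Ideal.IsPrime.radical ‹J.IsPrime›] at hFvan
    exact hFvan
  -- and `J` dies under `x ↦ g`
  set xg : Fin 3 × ι × ι → A := fun s => g s.1 s.2.1 s.2.2 with hxg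
  have hJle : J ≤ RingHom.ker (eval₂Hom ρ xg) := by
    rw [hJ, Ideal.span_le]
    rintro _ ⟨p, rfl⟩
    rw [SetLike.mem_coe, RingHom.mem_ker, map_sub, map_one, RingHom.map_det, sub_eq_zero]
    convert hg p using 2
    ext i j
    simp [hxg]
  have hJg : ∀ q ∈ J, eval₂Hom ρ xg q = 0 := fun q hq => hJle hq
  have h2 : eval₂Hom ρ xg F = eval₂ ρ (fun c : ι × ι × ι => actTensor (g 0) (g 1) (g 2)
      (fun a b c => ρ (w a b c)) c.1 c.2.1 c.2.2) f := by
    rw [hF, eval₂Hom_comp_aeval]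
    have e1 : ∀ p, (Xm p).map (eval₂Hom ρ xg) = g p := fun p => by
      ext i j; simp [hXm, hxg]
    have e2 : (fun a b c' => eval₂Hom ρ xg (C (w a b c') : MvPolynomial (Fin 3 × ι × ι) ℂ)) =
        fun a b c' => ρ (w a b c') := by
      funext a b c'; simp
    congr 1
    funext c
    rw [hsub, map_actTensor, e1, e1, e1, e2]
  rw [← h2]
  exact hJg F hFJ

/-! ### The torus curve -/

/-- Determinant of a diagonal matrix of integer powers: `det diag(s^{e_a}) = s^{Σ e}`. [folklore] -/
theorem det_diagonal_zpow {κ : Type*} [Field κ] (s : κ) (hs : s ≠ 0) (e : ι → ℤ) :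
    (diagonal fun a => s ^ e a).det = s ^ ∑ a, e a := by
  rw [det_diagonal]
  classical
  induction (Finset.univ : Finset ι) using Finset.induction_on with
  | empty => simp
  | insert a t ha ih => rw [Finset.prod_insert ha, Finset.sum_insert ha, ih, zpow_add₀ hs]

/-- **The torus curve.** Let `α, β, γ` be integer weights of total sums `0`, `z'` a point of the
`SL_ι(κ)³`-orbit of `w^ρ` over an infinite field `κ` vanishing on the cells of positive weight
`α a + β b + γ c > 0`, and `z` its truncation to the cells of weight `0`. Then every `f ∈ ℂ[y]`
vanishing on `SL_ι(ℂ)³·w` vanishes at `z` — the one-parameter subgroup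
`λ(s) = (diag s^{-α}, diag s^{-β}, diag s^{-γ})` gives a polynomial `s ↦ f^ρ(λ(s)·z')` vanishing for
all `s ≠ 0`, whose value at `s = 0` is `f^ρ(z)`. [folklore] -/
theorem eval₂_trunc_eq_zero_of_vanish (w : ι → ι → ι → ℂ) (f : MvPolynomial (ι × ι × ι) ℂ)
    (hf : ∀ g : Matrix.SpecialLinearGroup ι ℂ × Matrix.SpecialLinearGroup ι ℂ ×
        Matrix.SpecialLinearGroup ι ℂ,
      aeval (fun c : ι × ι × ι => actTensor (g.1 : Matrix ι ι ℂ) (g.2.1 : Matrix ι ι ℂ)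
        (g.2.2 : Matrix ι ι ℂ) w c.1 c.2.1 c.2.2) f = 0)
    {κ : Type*} [Field κ] [Infinite κ] (ρ : ℂ →+* κ) (α β γ : ι → ℤ)
    (hα : ∑ a, α a = 0) (hβ : ∑ b, β b = 0) (hγ : ∑ c, γ c = 0)
    (pinv : Fin 3 → Matrix ι ι κ) (hpinv : ∀ p, (pinv p).det = 1)
    (z : ι → ι → ι → κ)
    (hz0 : ∀ a b c, α a + β b + γ c = 0 → z a b c =
      actTensor (pinv 0) (pinv 1) (pinv 2) (fun a b c => ρ (w a b c)) a b c)
    (hzne : ∀ a b c, α a + β b + γ c ≠ 0 → z a b c = 0)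
    (hpos : ∀ a b c, 0 < α a + β b + γ c →
      actTensor (pinv 0) (pinv 1) (pinv 2) (fun a b c => ρ (w a b c)) a b c = 0) :
    eval₂ ρ (fun c : ι × ι × ι => z c.1 c.2.1 c.2.2) f = 0 := by
  classical
  set z' : ι → ι → ι → κ := actTensor (pinv 0) (pinv 1) (pinv 2) (fun a b c => ρ (w a b c))
    with hz'
  -- the curve, as a tensor of polynomials in `s`
  set Y : ι → ι → ι → Polynomial κ := fun a b c =>
    if α a + β b + γ c ≤ 0 then Polynomial.X ^ (-(α a + β b + γ c)).toNat * Polynomial.C (z' a b c)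
    else 0 with hY
  set Ff : Polynomial κ := eval₂ (Polynomial.C.comp ρ) (fun c : ι × ι × ι => Y c.1 c.2.1 c.2.2) f
    with hFf
  -- evaluating `Ff` at `s` is evaluating `f` at `Y(s)`
  have heval : ∀ s : κ, Polynomial.eval s Ff =
      eval₂ ρ (fun c : ι × ι × ι => Polynomial.eval s (Y c.1 c.2.1 c.2.2)) f := by
    intro s
    rw [hFf, ← coe_eval₂Hom, ← coe_eval₂Hom, ← Polynomial.coe_evalRingHom, ← RingHom.comp_apply]
    congr 1
    refine MvPolynomial.ringHom_ext (fun x => ?_) (fun c => ?_)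
    · simp
    · simp
  -- for `s ≠ 0`, `Y(s) = λ(s)·z'` lies in the orbit, so `Ff(s) = 0`
  have hroot : ∀ s : κ, s ≠ 0 → Polynomial.eval s Ff = 0 := by
    intro s hs
    rw [heval]
    set D : Fin 3 → Matrix ι ι κ := ![diagonal fun a => s ^ (-α a), diagonal fun b => s ^ (-β b),
      diagonal fun c => s ^ (-γ c)] with hD
    have hDdet : ∀ p, (D p * pinv p).det = 1 := by
      intro p
      rw [det_mul, hpinv p, mul_one]
      fin_cases p
      · show (diagonal fun a => s ^ (-α a)).det = 1
        rw [det_diagonal_zpow s hs, Finset.sum_neg_distrib, hα, neg_zero, zpow_zero]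
      · show (diagonal fun b => s ^ (-β b)).det = 1
        rw [det_diagonal_zpow s hs, Finset.sum_neg_distrib, hβ, neg_zero, zpow_zero]
      · show (diagonal fun c => s ^ (-γ c)).det = 1
        rw [det_diagonal_zpow s hs, Finset.sum_neg_distrib, hγ, neg_zero, zpow_zero]
    have hvan := eval₂_orbit_eq_zero_of_vanish w f hf ρ (fun p => D p * pinv p) hDdet
    have hYs : ∀ a b c, Polynomial.eval s (Y a b c) =
        actTensor (D 0 * pinv 0) (D 1 * pinv 1) (D 2 * pinv 2) (fun a b c => ρ (w a b c)) a b c := by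
      intro a b c
      rw [← actTensor_actTensor, ← hz']
      have hdiag : actTensor (D 0) (D 1) (D 2) z' a b c =
          s ^ (-α a) * s ^ (-β b) * s ^ (-γ c) * z' a b c := by
        show actTensor (diagonal fun a => s ^ (-α a)) (diagonal fun b => s ^ (-β b))
          (diagonal fun c => s ^ (-γ c)) z' a b c = _
        rw [actTensor_diagonal_apply]
      rw [hdiag, ← zpow_add₀ hs, ← zpow_add₀ hs]
      by_cases hw : α a + β b + γ c ≤ 0
      · simp only [hY, hw, if_true, Polynomial.eval_mul, Polynomial.eval_pow, Polynomial.eval_X,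
          Polynomial.eval_C]
        rw [← zpow_natCast, Int.toNat_of_nonneg (by omega)]
        congr 1
        ring_nf
      · have hp : 0 < α a + β b + γ c := lt_of_not_ge hw
        have h0 := hpos a b c hp
        simp only [hY, hw, if_false, Polynomial.eval_zero]
        simp only [hz'] at h0 ⊢
        rw [h0, mul_zero]
    simp_rw [hYs]
    exact hvan
  -- hence `Ff = 0`, and its value at `0` is `f^ρ(z)`
  have hFf0 : Ff = 0 := by
    apply Polynomial.eq_zero_of_infinite_isRoot
    refine Set.Infinite.mono (fun s (hs : s ∈ ({0}ᶜ : Set κ)) => ?_) (Set.Finite.infinite_compl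
      (Set.finite_singleton (0 : κ)))
    exact hroot s hs
  have h0 := heval 0
  rw [hFf0, Polynomial.eval_zero] at h0
  have hY0 : ∀ a b c, Polynomial.eval 0 (Y a b c) = z a b c := by
    intro a b c
    show Polynomial.eval 0 (if α a + β b + γ c ≤ 0 then
      Polynomial.X ^ (-(α a + β b + γ c)).toNat * Polynomial.C (z' a b c) else 0) = z a b c
    rcases lt_trichotomy (α a + β b + γ c) 0 with hlt | heq | hgt
    · rw [if_pos hlt.le, Polynomial.eval_mul, Polynomial.eval_pow, Polynomial.eval_X,
        zero_pow (by omega), zero_mul, hzne a b c hlt.ne]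
    · have hexp : (-(α a + β b + γ c)).toNat = 0 := by rw [heq]; rfl
      rw [if_pos heq.le, hexp, pow_zero, one_mul, Polynomial.eval_C, hz0 a b c heq]
    · rw [if_neg (not_le.mpr hgt), Polynomial.eval_zero, hzne a b c hgt.ne']
  simp_rw [hY0] at h0
  exact h0.symm

end Literature.RepresentationTheory.AlgebraicGroups
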